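import Literature.NumberTheory.EllipticCurves.GreenbergVatsal2000.NonPrimitiveDatumSelmerInvariants
import Literature.NumberTheory.EllipticCurves.Castella2018.AnticyclotomicSelmer
import Literature.NumberTheory.EllipticCurves.GreenbergSelmerDualDataExistsProofs
import HarnessLib

/-!
# Keller–Yin / Castella–Grossi–Lee–Skinner: the Selmer groups of a CHARACTER over the
# anticyclotomic tower (`𝓕_nr`, `𝓕_nr^S`, `𝓕_Gr`, `𝓕_Gr^S`) and their `Λ`-duals — DEFINITIONS ONLY,
# assembled from the tree's generic Greenberg–Vatsal / Castella constructors

Cell `bsd-eis` (FULL-BSD rank ≤ 1 programme, home `run/shared/lean/pub/bsd-eis/`), seat `bsd-eis-lit`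
gen 15: part 1 (D1 + D2 of LIT-DOSSIER §35 (B′)/(D′)) of the Literature DEFINITIONS the planner's
D-0074 execution spec (plan-g13/D0074-bsd-eis-seats.md, row E (i)) commissions for the kernel attack on
the K5 crux-2 residue `X1.KellerYinIMC2Halves.GoodLatticeMuLambdaOnTree` (KY §§1–2: "character Selmer
modules over `K_∞^{ac}` for `(F/𝓞)(θ)`"). DEFINITIONS AND PROVED LEMMAS ONLY: no named fact, no
`sorry`, nothing asserted about torsion-ness, `μ` or `λ` (those are KY Thm. 1.2.2 / Prop. 1.2.5 /
Thm. 1.5.1 — statements for the typer seat, D-0026). Part 2 (the local Euler factors `𝒫_w(θ) ∈ Λ`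
and the Katz `∃`-frame predicate) is left to the `k5-ty` seat.

Keller–Yin, arXiv:2402.12781v2, §1.2 Definition (TeX L641–667), for a character `θ : G_K → 𝓞ˣ`
(Teichmüller lift of `θ : G_K → 𝔽^×`), `M_θ = 𝓞(θ) ⊗ Λ^∨`, `p = v v̄` split in the imaginary
quadratic field `K`, `Σ ⊇ {∞, p, cond θ}` a finite set of places all SPLIT in `K`,
`S = Σ ∖ {v, v̄, ∞}`:
* `H¹_{𝓕_Gr}(K, M_θ) = ker (H¹(K^Σ/K, M_θ) → ∏_{w ∈ Σ, w ∤ p} H¹(K_w, M_θ) × H¹(K_v̄, M_θ))`,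
* `H¹_{𝓕_Gr^S}(K, M_θ) = ker (H¹(K^Σ/K, M_θ) → H¹(K_v̄, M_θ))`,
* `H¹_{𝓕_nr}(K, M_θ) = ker (H¹(K^Σ/K, M_θ) → ∏_{w ∈ Σ, w ∤ p} H¹(I_w, M_θ)^{G_w/I_w} × H¹(I_v̄, M_θ)^{G_v̄/I_v̄})`,
* `H¹_{𝓕_nr^S}(K, M_θ) = ker (H¹(K^Σ/K, M_θ) → H¹(I_v̄, M_θ)^{G_v̄/I_v̄})`
("relaxed at `v`", KY L670–673; CGLS 2022 §1.2 for `θ|_{G_v̄} ∉ {1, ω}`).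

`K_∞`-FORMULATION (Greenberg 1989 §1–2; KY Cor. `cohomology of Mtheta` L431: `H¹(K, M_θ) =
H¹(K_∞, (F/𝓞)(θ))`, Shapiro's lemma; as `Λ`-modules the two sides agree up to the involution
`ι : γ ↦ γ⁻¹` coming from the twist `Ψ⁻¹` in `M_θ` — immaterial for `Λ`-torsion-ness, `μ`, `λ`, and
for characteristic ideals up to `ι`, which is how KY/CGLS state their comparisons, cf. the `ι` in
KY Thm. 2.2.1): with `A = (F/𝓞)(θ)` = the tree's `GreenbergSelmer.Cofree θ F` at `n = 1`
and `H = Gal(K̄/K_∞) = ker κ`, `H¹(K^Σ/K, M_θ)` is the group of classes of `H¹(K_∞, A)` UNRAMIFIED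
outside `Σ` = the tree's `GreenbergVatsal2000.unramifiedOutside`, and the conditions above `p`
(none at `v`; at `v̄` "dies on `I_v̄`" resp. "dies on `D_v̄`") are Greenberg's INERTIA resp. STRICT
condition for the datum `M⁺_v = M`, `M⁺_v̄ = 0` = the tree's `Castella2018.AcSelmer.bdpData M p v̄`.
Hence, with NO new constructor:
* `H¹_{𝓕_nr^S}` := `GreenbergVatsal2000.datumSelmerInfty κ M (bdpData M p v̄) S` (`unrSelmer`),
* `H¹_{𝓕_Gr^S}` := `GreenbergVatsal2000.datumStrictSelmerInfty κ M (bdpData M p v̄) S` (`grSelmer`),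
and `S = ∅` gives `𝓕_nr` exactly; for `𝓕_Gr`, `S = ∅` gives "unramified" instead of "trivial" at the
finitely many `w ∈ Σ ∖ p` — the same group because such `w` are SPLIT in `K`, hence finitely
decomposed in `K_∞^{ac}` with `K_{∞,η} ⊇ K_w^{ur,p}`, so `H¹_ur(K_{∞,η}, A) = 0` (KY Remark 1.2.3(i)
L685–690 / Cor. `restriction away from p` L417; CGLS Thm. 1.2.2) — an identification NOT proved here.

MODELLING CAVEAT recorded in LIT-DOSSIER §35 (B′): the tree's OTHER anticyclotomic constructor
`Castella2018.AcSelmer.selmerOver` imposes local TRIVIALITY at every `w ∤ p` (correct for `E[p^∞]`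
by the Weil bound, NOT for a character with `θ(Frob_w) = 1` at an inert `w`); KY's groups impose
only unramifiedness outside `Σ`, which is why this file uses the Greenberg–Vatsal
restricted-ramification constructors.

## Contents
* §1 `unrSelmer`, `grSelmer` (generic discrete `Γ_K`-module `M`), unfolding lemmas.
* §2 conjugation stability of the strict group (`conjH1_mem_datumStrictSelmer`, the GV-level lemma
  the tree lacked), the `Γ`-action endomorphisms, local nilpotence of `γ − 1` for `p`-primary `M`
  with open stabilisers, and the `Λ = ℤ_p⟦T⟧`-module duals: `GreenbergVatsal2000.DatumDualData` for
  `unrSelmer` (existence `unrDualData`), and the mirror structure `GrDualData` for `grSelmer`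
  (existence `grDualData`).
* §3 characters: `θ : Γ_K →ₜ* GL₁(𝒪)`, `𝒪 = 𝒪_{ℚ_p(S)}`, `A = Cofree θ ℚ_p(S)`; unconditional
  existence of both dual data (`p`-primarity and open stabilisers are the tree's
  `exists_pow_smul_cofree_eq_zero` / `isOpen_stabilizer_cofree`).

## References
* [KellerYin2024] §1.2 Def. (L641–667), Rem. (i) (L685), Thm. `Rubin Hida` (L676), Prop. `Lambda invariants` (L780).
* [CastellaGrossiLeeSkinner2022] §1.2.
* [GreenbergVatsal2000] §2 pp. 16–17, 20 (restricted ramification, `Λ`-module structure).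
* [Greenberg1989] §1 p. 98; [GreenbergLNM1716] §1 (after Conj. 1.3).
-/

noncomputable section

open scoped Classical

open NumberField IsDedekindDomain Field
open Literature.NumberTheory.EllipticCurves Literature.NumberTheory.EllipticCurves.GreenbergSelmer
open Literature.NumberTheory.EllipticCurves.GreenbergVatsal2000
open Literature.NumberTheory.GaloisRepresentations

universe u

namespace Literature.NumberTheory.EllipticCurves.KellerYin2024

/-! ## §1 The four Selmer groups of a discrete module over `K_∞` -/

section Generic

variable {K : Type u} [Field K] [NumberField K] {p : ℕ} [Fact p.Prime] (κ : ZpExtension K p)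
  (M : Type u) [AddCommGroup M] [DistribMulAction (absoluteGaloisGroup K) M] [TopologicalSpace M]
  [DiscreteTopology M] (vbar : HeightOneSpectrum (𝓞 K)) (S₀ : Set (HeightOneSpectrum (𝓞 K)))

/-- **`H¹_{𝓕_nr^{S₀}}(K_∞, M)`** — Keller–Yin's `S₀`-imprimitive UNRAMIFIED Selmer group in the
`K_∞`-formulation: classes of `H¹(K_∞, M)` unramified at every place `∤ p` outside `S₀`, unramified
at (every place above) `v̄`, no condition above the other primes over `p` and none at `S₀`
(KY §1.2 Def. (4); `S₀ = ∅`: Def. (3), `𝓕_nr`). Greenberg–Vatsal's `S^{S₀}_M(K_∞)` for the datum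
"`M⁺ = 0` at `v̄`, `M⁺ = M` elsewhere above `p`". [cite: KellerYin2024, §1.2 Def. (3)–(4) (arXiv:2402.12781v2)]
[cite: GreenbergVatsal2000, §2 p. 20] -/
abbrev unrSelmer : AddSubgroup (subgroupH1 κ.kerSubgroup M) :=
  datumSelmerInfty κ M (Castella2018.AcSelmer.bdpData M p vbar) S₀

/-- **`H¹_{𝓕_Gr^{S₀}}(K_∞, M)`** — Keller–Yin's `S₀`-imprimitive GREENBERG Selmer group in the
`K_∞`-formulation: as `unrSelmer` but STRICT (locally trivial) at every place above `v̄`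
(KY §1.2 Def. (2); `S₀ = ∅`: Def. (1) `𝓕_Gr` up to "unramified = trivial" at the split places of
`Σ`, KY Rem. 1.2.3(i)). Greenberg–Vatsal's strict group `S^{S₀,str}_M(K_∞)` for the same datum.
[cite: KellerYin2024, §1.2 Def. (1)–(2) (arXiv:2402.12781v2)] [cite: GreenbergVatsal2000, §2 pp. 15, 20] -/
abbrev grSelmer : AddSubgroup (subgroupH1 κ.kerSubgroup M) :=
  datumStrictSelmerInfty κ M (Castella2018.AcSelmer.bdpData M p vbar) S₀

/-- `H¹_{𝓕_Gr^{S₀}} ≤ H¹_{𝓕_nr^{S₀}}` (strict implies unramified at `v̄`).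
[cite: KellerYin2024, §1.2 display (Gr,θ) (arXiv:2402.12781v2 TeX L736)] -/
theorem grSelmer_le_unrSelmer : grSelmer κ M vbar S₀ ≤ unrSelmer κ M vbar S₀ :=
  datumStrictSelmerInfty_le_datumSelmerInfty κ M _ S₀

/-- `H¹_{𝓕_nr^{S₀}} ≤ H¹_{𝓕_nr^{S₁}}` for `S₀ ⊆ S₁` (fewer conditions).
[cite: KellerYin2024, §1.2 ("one has an inclusion")] -/
theorem unrSelmer_mono {S₀ S₁ : Set (HeightOneSpectrum (𝓞 K))} (h : S₀ ⊆ S₁) :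
    unrSelmer κ M vbar S₀ ≤ unrSelmer κ M vbar S₁ :=
  datumSelmer_mono κ.kerSubgroup M p _ h

/-- `H¹_{𝓕_Gr^{S₀}} ≤ H¹_{𝓕_Gr^{S₁}}` for `S₀ ⊆ S₁`. [cite: KellerYin2024, §1.2] -/
theorem grSelmer_mono {S₀ S₁ : Set (HeightOneSpectrum (𝓞 K))} (h : S₀ ⊆ S₁) :
    grSelmer κ M vbar S₀ ≤ grSelmer κ M vbar S₁ :=
  datumStrictSelmer_mono κ.kerSubgroup M p _ h

/-! ## §2 `Γ`-action and the `Λ`-duals -/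

omit [Fact p.Prime] in
/-- The STRICT datum Selmer group `S^{S₀,str}_M(L)` is stable under `conj_τ`, `τ ∈ Γ_K` (all
conditions are imposed at every conjugate; `conj_σ ∘ conj_τ = conj_{στ}`) — the strict twin of the
tree's `GreenbergVatsal2000.conjH1_mem_datumSelmer`. [cite: GreenbergVatsal2000, §2 p. 17] -/
theorem conjH1_mem_datumStrictSelmer (H : Subgroup (absoluteGaloisGroup K)) [H.Normal]
    (L : Data K M p) (τ : absoluteGaloisGroup K) {c : subgroupH1 H M}
    (hc : c ∈ datumStrictSelmer H M p L S₀) : conjH1 H M τ c ∈ datumStrictSelmer H M p L S₀ := by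
  rw [mem_datumStrictSelmer_iff] at hc ⊢
  refine ⟨conjH1_mem_unramifiedOutside H M p S₀ τ hc.1, fun v hv σ ↦ ?_⟩
  have h := hc.2 v hv (σ * τ)
  rwa [Literature.NumberTheory.EllipticCurves.conjH1_mul_holds H M σ τ,
    AddMonoidHom.comp_apply] at h

/-- `conj_γ` as an endomorphism of `H¹_{𝓕_nr^{S₀}}(K_∞, M)`. [cite: GreenbergVatsal2000, §2 p. 17] -/
def conjUnr (γ : absoluteGaloisGroup K) : AddMonoid.End (unrSelmer κ M vbar S₀) :=
  ((conjH1 κ.kerSubgroup M γ).restrict (unrSelmer κ M vbar S₀)).codRestrict (unrSelmer κ M vbar S₀)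
    fun s ↦ conjH1_mem_datumSelmer κ.kerSubgroup M p _ S₀ γ s.2

/-- `conj_γ` as an endomorphism of `H¹_{𝓕_Gr^{S₀}}(K_∞, M)`. [cite: GreenbergVatsal2000, §2 p. 17] -/
def conjGr (γ : absoluteGaloisGroup K) : AddMonoid.End (grSelmer κ M vbar S₀) :=
  ((conjH1 κ.kerSubgroup M γ).restrict (grSelmer κ M vbar S₀)).codRestrict (grSelmer κ M vbar S₀)
    fun s ↦ conjH1_mem_datumStrictSelmer M S₀ κ.kerSubgroup _ γ s.2

/-- Unfolding `conjUnr` (definitional; private plumbing). [folklore] -/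
@[simp]
private theorem coe_conjUnr_apply (γ : absoluteGaloisGroup K) (s : unrSelmer κ M vbar S₀) :
    ((conjUnr κ M vbar S₀ γ s : unrSelmer κ M vbar S₀) : subgroupH1 κ.kerSubgroup M) =
      conjH1 κ.kerSubgroup M γ s :=
  rfl

/-- Unfolding `conjGr` (definitional; private plumbing). [folklore] -/
@[simp]
private theorem coe_conjGr_apply (γ : absoluteGaloisGroup K) (s : grSelmer κ M vbar S₀) :
    ((conjGr κ M vbar S₀ γ s : grSelmer κ M vbar S₀) : subgroupH1 κ.kerSubgroup M) =
      conjH1 κ.kerSubgroup M γ s :=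
  rfl

/-- Powers: `(conjUnr γ)^m = conj_{γ^m}` (`conjH1_one`, `conjH1_mul`). [folklore] -/
private theorem coe_conjUnr_pow_apply (γ : absoluteGaloisGroup K) (m : ℕ) (s : unrSelmer κ M vbar S₀) :
    ((((conjUnr κ M vbar S₀ γ) ^ m) s : unrSelmer κ M vbar S₀) : subgroupH1 κ.kerSubgroup M) =
      conjH1 κ.kerSubgroup M (γ ^ m) s := by
  induction m generalizing s with
  | zero => rw [pow_zero, pow_zero, AddMonoid.End.one_apply,
      Literature.NumberTheory.EllipticCurves.conjH1_one_holds κ.kerSubgroup M, AddMonoidHom.id_apply]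
  | succ m ih =>
    rw [pow_succ, AddMonoid.End.coe_mul, Function.comp_apply, ih, coe_conjUnr_apply, pow_succ,
      Literature.NumberTheory.EllipticCurves.conjH1_mul_holds κ.kerSubgroup M, AddMonoidHom.comp_apply]

/-- Powers: `(conjGr γ)^m = conj_{γ^m}` (`conjH1_one`, `conjH1_mul`). [folklore] -/
private theorem coe_conjGr_pow_apply (γ : absoluteGaloisGroup K) (m : ℕ) (s : grSelmer κ M vbar S₀) :
    ((((conjGr κ M vbar S₀ γ) ^ m) s : grSelmer κ M vbar S₀) : subgroupH1 κ.kerSubgroup M) =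
      conjH1 κ.kerSubgroup M (γ ^ m) s := by
  induction m generalizing s with
  | zero => rw [pow_zero, pow_zero, AddMonoid.End.one_apply,
      Literature.NumberTheory.EllipticCurves.conjH1_one_holds κ.kerSubgroup M, AddMonoidHom.id_apply]
  | succ m ih =>
    rw [pow_succ, AddMonoid.End.coe_mul, Function.comp_apply, ih, coe_conjGr_apply, pow_succ,
      Literature.NumberTheory.EllipticCurves.conjH1_mul_holds κ.kerSubgroup M, AddMonoidHom.comp_apply]

variable {M}

/-- **`T = γ − 1` is locally nilpotent on `H¹_{𝓕_nr^{S₀}}(K_∞, M)` and the group is `p`-primary**,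
for `M` `p`-primary with open stabilisers and `γ` a topological generator: Greenberg, LNM 1716 §1
("a torsion `ℤ_p`-module, every element of which is killed by `Tⁿ`"), via the tree's generic tower
lemmas. [cite: GreenbergLNM1716, §1 (after Conj. 1.3)] -/
theorem isLocNil_conjUnr_sub_one (htor : ∀ m : M, ∃ k : ℕ, p ^ k • m = 0)
    (hstab : ∀ m : M, IsOpen (MulAction.stabilizer (absoluteGaloisGroup K) m : Set (absoluteGaloisGroup K)))
    {γ : absoluteGaloisGroup K} (hγ : κ.IsTopGenerator γ) :
    IwasawaDual.IsLocNil p (conjUnr κ M vbar S₀ γ - 1) := by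
  have htor' : ∀ s : unrSelmer κ M vbar S₀, ∃ k : ℕ, p ^ k • s = 0 := fun s ↦ by
    obtain ⟨k, hk⟩ := GreenbergSelmer.exists_pow_smul_subgroupH1_eq_zero κ M htor
      (s : subgroupH1 κ.kerSubgroup M)
    exact ⟨k, Subtype.ext (by rw [AddSubgroupClass.coe_nsmul]; exact hk)⟩
  refine ⟨htor', fun s ↦ ?_⟩
  obtain ⟨a, ha⟩ := GreenbergSelmer.exists_conjH1_pow_prime_pow_eq κ M hstab hγ
    (s : subgroupH1 κ.kerSubgroup M)
  obtain ⟨k, hk⟩ := htor' s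
  have hφ : ((conjUnr κ M vbar S₀ γ) ^ p ^ a) s = s :=
    Subtype.ext (by rw [coe_conjUnr_pow_apply]; exact ha)
  exact ⟨k * p ^ a, IwasawaDual.pow_mul_prime_pow_apply_eq_zero (Fact.out : p.Prime) _ a hφ hk⟩

/-- The strict twin of `isLocNil_conjUnr_sub_one`. [cite: GreenbergLNM1716, §1 (after Conj. 1.3)] -/
theorem isLocNil_conjGr_sub_one (htor : ∀ m : M, ∃ k : ℕ, p ^ k • m = 0)
    (hstab : ∀ m : M, IsOpen (MulAction.stabilizer (absoluteGaloisGroup K) m : Set (absoluteGaloisGroup K)))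
    {γ : absoluteGaloisGroup K} (hγ : κ.IsTopGenerator γ) :
    IwasawaDual.IsLocNil p (conjGr κ M vbar S₀ γ - 1) := by
  have htor' : ∀ s : grSelmer κ M vbar S₀, ∃ k : ℕ, p ^ k • s = 0 := fun s ↦ by
    obtain ⟨k, hk⟩ := GreenbergSelmer.exists_pow_smul_subgroupH1_eq_zero κ M htor
      (s : subgroupH1 κ.kerSubgroup M)
    exact ⟨k, Subtype.ext (by rw [AddSubgroupClass.coe_nsmul]; exact hk)⟩
  refine ⟨htor', fun s ↦ ?_⟩
  obtain ⟨a, ha⟩ := GreenbergSelmer.exists_conjH1_pow_prime_pow_eq κ M hstab hγ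
    (s : subgroupH1 κ.kerSubgroup M)
  obtain ⟨k, hk⟩ := htor' s
  have hφ : ((conjGr κ M vbar S₀ γ) ^ p ^ a) s = s :=
    Subtype.ext (by rw [coe_conjGr_pow_apply]; exact ha)
  exact ⟨k * p ^ a, IwasawaDual.pow_mul_prime_pow_apply_eq_zero (Fact.out : p.Prime) _ a hφ hk⟩

/-- **`𝔛^{S₀,nr} = H¹_{𝓕_nr^{S₀}}(K_∞, M)^∨ = Hom(·, ℚ/ℤ)` with its `Λ = ℤ_p⟦T⟧`-structure, `T = γ − 1`**
(a `GreenbergVatsal2000.DatumDualData`, `toDual = id`), for `M` `p`-primary with open stabilisers.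
KY: "`H¹_{𝓕_nr}(K, M_θ)^∨`", Thm. `Rubin Hida`. [cite: KellerYin2024, Thm. 1.2.2 (`Rubin Hida`, arXiv:2402.12781v2 TeX L676)]
[cite: GreenbergVatsal2000, §2 p. 17] -/
def unrDualData (htor : ∀ m : M, ∃ k : ℕ, p ^ k • m = 0)
    (hstab : ∀ m : M, IsOpen (MulAction.stabilizer (absoluteGaloisGroup K) m : Set (absoluteGaloisGroup K)))
    {γ : absoluteGaloisGroup K} (hγ : κ.IsTopGenerator γ) :
    DatumDualData κ γ M (Castella2018.AcSelmer.bdpData M p vbar) S₀ :=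
  { X := unrSelmer κ M vbar S₀ →+ AddCircle (1 : ℚ)
    module := (isLocNil_conjUnr_sub_one κ vbar S₀ htor hstab hγ).module
    toDual := AddMonoidHom.id _
    bijective := Function.bijective_id
    toDual_T_smul := fun x s ↦ by
      show (isLocNil_conjUnr_sub_one κ vbar S₀ htor hstab hγ).smulFun PowerSeries.X x s = x _ - x s
      rw [(isLocNil_conjUnr_sub_one κ vbar S₀ htor hstab hγ).smulFun_X_apply,
        IwasawaDual.End_sub_apply, AddMonoid.End.one_apply, map_sub]
      rfl
    toDual_C_smul := fun c x s k hk ↦ by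
      show (isLocNil_conjUnr_sub_one κ vbar S₀ htor hstab hγ).smulFun (PowerSeries.C c) x s = _
      exact (isLocNil_conjUnr_sub_one κ vbar S₀ htor hstab hγ).smulFun_C_apply c x hk }

variable (M) in
/-- **Pontryagin-dual data for the STRICT group `H¹_{𝓕_Gr^{S₀}}(K_∞, M)`** (KY's `𝔛_θ^{S}`-type
module for `𝓕_Gr`): verbatim `GreenbergVatsal2000.DatumDualData` with `datumSelmerInfty` replaced
by `datumStrictSelmerInfty` (= `grSelmer`). [cite: KellerYin2024, §1.2 (arXiv:2402.12781v2)]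
[cite: GreenbergVatsal2000, §2 p. 17] -/
structure GrDualData (γ : absoluteGaloisGroup K) where
  /-- The underlying type of `X = H¹_{𝓕_Gr^{S₀}}(K_∞, M)^∨`. -/
  X : Type u
  /-- `X` is an abelian group. -/
  [addCommGroup : AddCommGroup X]
  /-- `X` is a `Λ = ℤ_p⟦T⟧`-module. -/
  [module : Module (IwasawaAlgebra p) X]
  /-- The identification with the character group. -/
  toDual : X →+ (grSelmer κ M vbar S₀ →+ AddCircle (1 : ℚ))
  /-- `toDual` is a group isomorphism. -/
  bijective : Function.Bijective toDual
  /-- `T` acts as `γ − 1`. -/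
  toDual_T_smul : ∀ (x : X) (s : grSelmer κ M vbar S₀),
    toDual ((PowerSeries.X : IwasawaAlgebra p) • x) s = toDual x (conjGr κ M vbar S₀ γ s) - toDual x s
  /-- Constants `c ∈ ℤ_p` act on `p^k`-torsion classes through `ℤ_p → ℤ/p^k`. -/
  toDual_C_smul : ∀ (c : ℤ_[p]) (x : X) (s : grSelmer κ M vbar S₀) (k : ℕ), (p ^ k) • s = 0 →
    toDual (PowerSeries.C c • x) s = (PadicInt.toZModPow k c).val • toDual x s

attribute [instance] GrDualData.addCommGroup GrDualData.module

/-- **`𝔛^{S₀,Gr} = H¹_{𝓕_Gr^{S₀}}(K_∞, M)^∨` with its `Λ`-structure IS a `GrDualData`** (`toDual = id`),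
for `M` `p`-primary with open stabilisers. [cite: KellerYin2024, §1.2 (arXiv:2402.12781v2)]
[cite: GreenbergLNM1716, §1 (after Conj. 1.3)] -/
def grDualData (htor : ∀ m : M, ∃ k : ℕ, p ^ k • m = 0)
    (hstab : ∀ m : M, IsOpen (MulAction.stabilizer (absoluteGaloisGroup K) m : Set (absoluteGaloisGroup K)))
    {γ : absoluteGaloisGroup K} (hγ : κ.IsTopGenerator γ) : GrDualData κ M vbar S₀ γ :=
  { X := grSelmer κ M vbar S₀ →+ AddCircle (1 : ℚ)
    module := (isLocNil_conjGr_sub_one κ vbar S₀ htor hstab hγ).module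
    toDual := AddMonoidHom.id _
    bijective := Function.bijective_id
    toDual_T_smul := fun x s ↦ by
      show (isLocNil_conjGr_sub_one κ vbar S₀ htor hstab hγ).smulFun PowerSeries.X x s = x _ - x s
      rw [(isLocNil_conjGr_sub_one κ vbar S₀ htor hstab hγ).smulFun_X_apply,
        IwasawaDual.End_sub_apply, AddMonoid.End.one_apply, map_sub]
    toDual_C_smul := fun c x s k hk ↦ by
      show (isLocNil_conjGr_sub_one κ vbar S₀ htor hstab hγ).smulFun (PowerSeries.C c) x s = _
      exact (isLocNil_conjGr_sub_one κ vbar S₀ htor hstab hγ).smulFun_C_apply c x hk }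

end Generic

/-! ## §3 Characters `θ : Γ_K → GL₁(𝒪)`, `𝒪 = 𝒪_{ℚ_p(S)}`: `A = (F/𝒪)(θ)` and the two duals exist -/

section Character

variable {K : Type} [Field K] [NumberField K] {p : ℕ} [Fact p.Prime] (S : Set (PadicAlgCl p))
  (θ : FramedGaloisRep K (padicCoeffIntegers S) 1) (κ : ZpExtension K p)
  (vbar : HeightOneSpectrum (𝓞 K)) (S₀ : Set (HeightOneSpectrum (𝓞 K)))

/-- **`(F/𝒪)(θ)`** — the rank-one cofree module of the character `θ : Γ_K → 𝒪ˣ = GL₁(𝒪)`,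
`F = ℚ_p(S)`, `𝒪 = 𝒪_F` (KY §1.1: "`M_θ = 𝓞(θ) ⊗ Λ^∨` … `0 → (F/𝓞)(θ) → M_θ →·T M_θ → 0`",
TeX L441–449), i.e. the tree's `GreenbergSelmer.Cofree θ F` at `n = 1`.
[cite: KellerYin2024, §1.1 (arXiv:2402.12781v2 TeX L441–449)] [cite: Greenberg1989, §1 p. 98] -/
abbrev charModule : Type := Cofree θ (padicCoeffField S)

/-- **Existence of `H¹_{𝓕_nr^{S₀}}(K_∞, (F/𝒪)(θ))^∨` as a `Λ`-module** for every topological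
generator `γ`: the points of `(F/𝒪)(θ)` are `p`-primary with open stabilisers (tree:
`exists_pow_smul_cofree_eq_zero`, `isOpen_stabilizer_cofree`). [cite: KellerYin2024, Thm. 1.2.2 (`Rubin Hida`)]
[cite: GreenbergLNM1716, §1 (after Conj. 1.3)] -/
theorem nonempty_unrDualData_char {γ : absoluteGaloisGroup K} (hγ : κ.IsTopGenerator γ) :
    Nonempty (DatumDualData κ γ (charModule S θ)
      (Castella2018.AcSelmer.bdpData (charModule S θ) p vbar) S₀) :=
  ⟨unrDualData κ vbar S₀ (exists_pow_smul_cofree_eq_zero S θ) (isOpen_stabilizer_cofree S θ) hγ⟩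

/-- **Existence of `H¹_{𝓕_Gr^{S₀}}(K_∞, (F/𝒪)(θ))^∨` as a `Λ`-module.**
[cite: KellerYin2024, §1.2 (arXiv:2402.12781v2)] [cite: GreenbergLNM1716, §1 (after Conj. 1.3)] -/
theorem nonempty_grDualData_char {γ : absoluteGaloisGroup K} (hγ : κ.IsTopGenerator γ) :
    Nonempty (GrDualData κ (charModule S θ) vbar S₀ γ) :=
  ⟨grDualData κ vbar S₀ (exists_pow_smul_cofree_eq_zero S θ) (isOpen_stabilizer_cofree S θ) hγ⟩

end Character

end Literature.NumberTheory.EllipticCurves.KellerYin2024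

end
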